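import Literature.NumberTheory.Automorphic.LocalUnitaryGroupCongrMeasure   -- ★ instances `locallyCompactSpace_cmDatum_local`, `secondCountableTopology_cmDatum_local`
import Literature.NumberTheory.Automorphic.UnitaryGroupLineBorelRing          -- ★ `LineRing.isClosed_unipotentU` (the unipotent radical is closed)
import Literature.NumberTheory.Automorphic.CMLocalNonsplitBorelTransport       -- ★ `conjLocal`, `cmLocalForm` (the CM local Borel data)
import Mathlib.MeasureTheory.Measure.Haar.Basic
import HarnessLib

/-!
# A Haar measure on the unipotent radical `N(L⁺_v)` of the local CM unitary group `U(Φ_N)(L⁺_v)` exists and is s-finite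

Topic `NumberTheory/Automorphic`; namespace `Literature.NumberTheory.Automorphic.UnitaryGroup`.  THEOREMS ONLY (no definition, no
instance, no notation, no `sorry`).

WHY.  The Levi-row vehicles of the (D-RAM) four-frame road (the unipotent-fibre volumes of a test function, Rogawski 1990 §4.3 (4.3.1)∕Lemma
4.9.2: `Φ^{st}(γ_H, f^H) = D_{G∕H}(γ)·∫_N f(γ n) dn` on the Levi population) are typed with «any Haar measure `μ_N` on `N(L⁺_v)` with
`[μ_N.IsHaarMeasure] [SFinite μ_N]`» as BINDERS handed by the producer (e.g. `rowThree_levels_hFamily_of_scalar`,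
`rowThree_gselStar_of_leviIdentity`), while the H-side triples they are assembled into carry no such binder.  This file discharges the binder once:
given the Borel structure on the local group (always a hypothesis in this tree), SOME s-finite Haar measure on the unipotent radical exists —
`N` is a closed subgroup (★ `LineRing.isClosed_unipotentU`) of the locally compact, second countable group `U(Φ_N)(L⁺_v)` (★
`locallyCompactSpace_cmDatum_local`, ★ `secondCountableTopology_cmDatum_local`, transported along the definitional identity
`(cmDatum L N Φ_N).Local v = ↥(unitaryGroupOfForm (conjLocal L c v) (cmLocalForm L N v))`), hence locally compact and second countable, so
Mathlib's `MeasureTheory.Measure.haar` is a Haar measure on it, locally finite, σ-finite and therefore s-finite.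

* `exists_isHaarMeasure_sFinite_unipotentU` — `∃ μN : Measure ↥(unipotentU (conjLocal L c v) (cmLocalForm L N v)), μN.IsHaarMeasure ∧ SFinite μN`.

## References
* [Rogawski1990] J. D. Rogawski, *Automorphic Representations of Unitary Groups in Three Variables*, Ann. of Math. Stud. 123 (1990), §4.3 (4.3.1) p. 43,
  Lemma 4.9.2 p. 56 (orbital integrals on the Levi population as unipotent integrals).
* [PlatonovRapinchuk1994] V. Platonov, A. Rapinchuk, *Algebraic Groups and Number Theory* (1994), §3.5 (closed subgroups of `p`-adic groups are
  locally compact), §5.1 (Haar measure on `p`-adic groups).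
-/

set_option autoImplicit false

noncomputable section

namespace Literature.NumberTheory.Automorphic.UnitaryGroup

open _root_.MeasureTheory _root_.MeasureTheory.Measure _root_.NumberField _root_.IsDedekindDomain _root_.Topology
open scoped Matrix MatrixGroups

/-- **An s-finite Haar measure on the unipotent radical `N(L⁺_v) ≤ U(Φ_N)(L⁺_v)` exists** (for any Borel structure on the local group):
`N` is closed (★ `LineRing.isClosed_unipotentU`) in the locally compact second countable group `U(Φ_N)(L⁺_v)` (the ★ `cmDatum` instances,
transported along `(cmDatum L N Φ_N).Local v = ↥(unitaryGroupOfForm (conjLocal L c v) (cmLocalForm L N v))`, a definitional identity), so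
`Measure.haar` on it is a Haar measure and, being locally finite on a second countable space, σ-finite, hence s-finite.
[cite: PlatonovRapinchuk1994, §3.5, §5.1] [cite: Rogawski1990, §4.3 (4.3.1) p. 43] -/
theorem exists_isHaarMeasure_sFinite_unipotentU (L : Type) [Field L] [NumberField L] [IsCMField L] (N : ℕ)
    (v : HeightOneSpectrum (𝓞 ↥(maximalRealSubfield L)))
    [MeasurableSpace ↥(unitaryGroupOfForm (conjLocal L (IsCMField.complexConj L) v) (cmLocalForm L N v))]
    [BorelSpace ↥(unitaryGroupOfForm (conjLocal L (IsCMField.complexConj L) v) (cmLocalForm L N v))] :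
    ∃ μN : Measure ↥(unipotentU (conjLocal L (IsCMField.complexConj L) v) (cmLocalForm L N v)), μN.IsHaarMeasure ∧ SFinite μN := by
  -- the local group is locally compact and second countable (★ instances on the `cmDatum` carrier, same type by `rfl`)
  haveI : LocallyCompactSpace ↥(unitaryGroupOfForm (conjLocal L (IsCMField.complexConj L) v) (cmLocalForm L N v)) :=
    (inferInstance : LocallyCompactSpace ((cmDatum L N (Matrix.of fun i j : Fin N => if i.val + j.val + 1 = N then (1 : L) else 0)).Local v))
  haveI : SecondCountableTopology ↥(unitaryGroupOfForm (conjLocal L (IsCMField.complexConj L) v) (cmLocalForm L N v)) :=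
    (inferInstance : SecondCountableTopology ((cmDatum L N (Matrix.of fun i j : Fin N => if i.val + j.val + 1 = N then (1 : L) else 0)).Local v))
  -- the unipotent radical is a closed subgroup, hence locally compact and second countable
  have hN : IsClosed (unipotentU (conjLocal L (IsCMField.complexConj L) v) (cmLocalForm L N v) :
      Set ↥(unitaryGroupOfForm (conjLocal L (IsCMField.complexConj L) v) (cmLocalForm L N v))) := LineRing.isClosed_unipotentU _ _
  haveI : LocallyCompactSpace ↥(unipotentU (conjLocal L (IsCMField.complexConj L) v) (cmLocalForm L N v)) :=
    hN.isClosedEmbedding_subtypeVal.locallyCompactSpace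
  haveI : SecondCountableTopology ↥(unipotentU (conjLocal L (IsCMField.complexConj L) v) (cmLocalForm L N v)) :=
    TopologicalSpace.Subtype.secondCountableTopology _
  -- Mathlib's Haar measure on it: Haar, locally finite, σ-finite, s-finite
  let μ0 : Measure ↥(unipotentU (conjLocal L (IsCMField.complexConj L) v) (cmLocalForm L N v)) := Measure.haar
  haveI hH0 : μ0.IsHaarMeasure := by show (Measure.haar).IsHaarMeasure; infer_instance
  haveI : IsLocallyFiniteMeasure μ0 := inferInstance
  haveI hσ : SigmaFinite μ0 := inferInstance
  exact ⟨μ0, hH0, @instSFiniteOfSigmaFinite _ _ μ0 hσ⟩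

end Literature.NumberTheory.Automorphic.UnitaryGroup

end
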